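import Literature.AlgebraicGeometry.CossartJannsenSaito2020.ProjDirProjectiveLineCharts
import Literature.AlgebraicGeometry.Resolution.StrictNormalCrossingsFlatDescent
import Mathlib.RingTheory.Localization.Ideal
import Mathlib.RingTheory.DedekindDomain.Dvr
import Mathlib.RingTheory.DiscreteValuationRing.TFAE
import Mathlib.RingTheory.KrullDimension.Field
import Mathlib.RingTheory.Localization.Submodule
import Mathlib.Algebra.Polynomial.FieldDivision
import HarnessLib

/-!
# CJS LNM 2270, Def. 6.38 (ii) at `e_x(X) = 2`: the local rings of `C_1 = ℙ(Dir_x(X)) ⊂ Bℓ_x(X)` are regular of dimension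
# one — PROOF of the local clause of `ProjDir_projLine`, and the DISCHARGE `ProjDir_projLine_holds`

Source: V. Cossart, U. Jannsen, S. Saito, *Desingularization: Invariants and Strategy*, LNM **2270** (2020)
[`CossartJannsenSaito2020`], Def. 6.38 (ii) (p. 105) «`C_1 = ℙ(Dir^O_x(X)) ≅ ℙ^1_{k(x)}`», p. 103 L30 (`dim(𝒪_{C_1,y})` in the
proof of Lemma 6.33). Continuation of `ProjDirProjectiveLineCharts.lean` (topological clauses). Here: for a blow-up
`π : X' → X` of a locally noetherian `X` in a closed point `x` with `e_x(X) = 2` and `C = projDirectrixFibre π x` (closed,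
irreducible, generic point `η`), the local ring `𝒪_{C,y} = 𝒪_{X',y}/𝓘_{C,y}` of the reduced closed subscheme structure
(Mathlib `Scheme.IdealSheafData.vanishingIdeal`, tree `stalkIdeal`) at every `y ∈ C` is a REGULAR local ring, of Krull
dimension `1` at `y ≠ η` and `0` at `y = η` (`projDirectrixFibre_projLine_local`); with the topological clauses this proves
the named fact: **`ProjDir_projLine_holds : ProjDir_projLine`**.

Proof. `C = closure {η}`, so `𝓘_{C,y}` is the prime `𝔭_η ⊆ 𝒪_{X',y}` of the generisation `η ⤳ y` (tree
`stalkIdeal_vanishingIdeal_closure`). On a blow-up chart `g : Spec D → X'` through `y = g(w)` (one of the two charts at the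
adapted pair `c_{j₀}, c_{j₁}` of `ProjDirProjectiveLineCharts.lean`), `η = g(𝔑)` for the explicit prime `𝔑` with
`D/𝔑 ≅ k(x)[T]` (`ProjDirectrixPlaneChart.lean`); under `𝒪_{X',y} ≅ 𝒪_{Spec D,w} = D_w` the prime `𝔭_η` becomes `𝔑 D_w`
(naturality of specialisation maps, `Scheme.Hom.stalkSpecializes_stalkMap`; `IsLocalization.map_under`), so
`𝒪_{C,y} ≅ D_w/𝔑 D_w`, a localisation of `D/𝔑 ≅ k(x)[T]` at a prime (Mathlib: localisation commutes with quotients): a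
discrete valuation ring (dimension `1`) at a nonzero prime, the field `k(x)(T)` (dimension `0`) at `𝔑` itself.

Boundary-free. NOT a statement of H. Hironaka's manuscript; a PROOF of a typed published statement of [CJS 2020] for the
L-lane of cell res-hironaka ([L W4.2], deal P-a, RECOGNITION (R1): «regularity + irreducibility + generic point of
`T.projDir x`»). AI-written; weaker than expert review. `ProjDir_projLine_residueFields` is NOT proved here.

## References

* V. Cossart, U. Jannsen, S. Saito, LNM 2270 (2020), Def. 6.34 (i), Def. 6.38 (ii), Lemma 6.33, p. 103, p. 105.
  [CossartJannsenSaito2020]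
* The Stacks Project, Tag 0804 (charts of a blowing up), Tag 01J7 (points of `Spec 𝒪_{X,x}`). [StacksProject]
-/

noncomputable section

open CategoryTheory AlgebraicGeometry TopologicalSpace IsLocalRing
open Literature.AlgebraicGeometry.Resolution Literature.RingTheory.HilbertSamuel Literature.RingTheory.MvPolynomial

namespace Literature.AlgebraicGeometry.CossartJannsenSaito2020

universe u

/-! ## Plumbing (private copies of the chart lemmas of `ProjDirClosed.lean`) -/

/-- The chart `g_j : Spec (R[It])_{(c_j t)} → X'` of a blowing up along `C` over an affine open `U` at a member `c_j` of a
generating family `c` of `C(U)`: an open immersion over `Spec R → X` through `chartBase c j`, containing every point at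
which `c_j` generates the exceptional ideal. [cite: StacksProject, Tag 0804] -/
private theorem exists_chart_of_ideal_eq_span₃ {X' X : Scheme.{u}} {π : X' ⟶ X} {C : X.IdealSheafData}
    (hπ : IsBlowup π C) (U : X.affineOpens) {r : ℕ} (c : Fin r → Γ(X, U))
    (hc : C.ideal U = Ideal.span (Set.range c)) (j : Fin r) :
    ∃ g : Spec (.of (chartRing c j)) ⟶ X', IsOpenImmersion g ∧
      g ≫ π = Spec.map (CommRingCat.ofHom (chartBase c j)) ≫ U.2.fromSpec ∧
      ∀ (x' : X') (hx : π x' ∈ (U : X.Opens)),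
        stalkIdeal (C.comap π) x' =
            Ideal.span {(π.stalkMap x').hom ((X.presheaf.germ U (π x') hx).hom (c j))} →
          x' ∈ Set.range g := by
  have key : ∀ (I : Ideal Γ(X, U)) (_ : C.ideal U = I) (b : Γ(X, U)) (hb : b ∈ I),
      ∃ g : Spec (.of (HomogeneousLocalization.Away (reesGrading I) (reesT b hb))) ⟶ X',
        IsOpenImmersion g ∧
        g ≫ π = Spec.map (CommRingCat.ofHom (reesChartBase b hb)) ≫ U.2.fromSpec ∧
        ∀ (x' : X') (hx : π x' ∈ (U : X.Opens)),
          stalkIdeal (C.comap π) x' =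
              Ideal.span {(π.stalkMap x').hom ((X.presheaf.germ U (π x') hx).hom b)} →
            x' ∈ Set.range g := by
    rintro I rfl b hb
    obtain ⟨g, h1, h2, -⟩ := hπ.exists_charts U
    exact ⟨g b hb, h1 b hb, h2 b hb, fun x' hx hgen =>
      hπ.mem_range_chart_of_stalkIdeal_eq_span U hb (g b hb) (h2 b hb) hx hgen⟩
  exact key _ hc (c j) (Ideal.mem_span_range_self (f := c) (x := j))

/-- On a chart `g : Spec D → X'` with `g ≫ π = Spec f ≫ (Spec Γ(X, U) → X)`:
`g^♯_w ∘ π^♯_{g w} ∘ germ = (D → 𝒪_{Spec D, w}) ∘ f`. [cite: StacksProject, Tag 0804] -/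
private theorem stalkMap_stalkMap_germ_of_chart₃ {X' X : Scheme.{u}} (π : X' ⟶ X) (U : X.affineOpens)
    {D : CommRingCat.{u}} (g : Spec D ⟶ X') (f : Γ(X, U) ⟶ D)
    (hg : g ≫ π = Spec.map f ≫ U.2.fromSpec) (w : Spec D) (hx : π (g w) ∈ (U : X.Opens)) (r : Γ(X, U)) :
    (g.stalkMap w).hom ((π.stalkMap (g w)).hom ((X.presheaf.germ U (π (g w)) hx).hom r)) =
      ((Spec D).presheaf.germ ⊤ w trivial).hom ((Scheme.ΓSpecIso D).inv.hom (f.hom r)) := by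
  have e := top_le_preimage_of_chart U g f hg
  have h1 : ((Spec D).presheaf.germ ⊤ w trivial).hom ((g ≫ π).appLE U ⊤ e r) =
      ((g ≫ π).stalkMap w).hom ((X.presheaf.germ U ((g ≫ π) w) (e trivial)).hom r) := by
    change ((g ≫ π).appLE U ⊤ e ≫ (Spec D).presheaf.germ ⊤ w trivial).hom r =
      (X.presheaf.germ U ((g ≫ π) w) (e trivial) ≫ (g ≫ π).stalkMap w).hom r
    rw [Scheme.Hom.germ_stalkMap, Scheme.Hom.appLE, Category.assoc, (Spec D).presheaf.germ_res]
  rw [appLE_chart_eq U g f hg e, Scheme.Hom.stalkMap_comp] at h1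
  exact h1.symm


/-! ## Ring-level facts (private copies) -/
section Quotient

variable {D : Type u} [CommRing D] {k : Type u} [Field k] (N : Ideal D) (Ξ : Polynomial k ≃+* D ⧸ N)

include Ξ in
/-- An ideal with quotient `≅ k[T]` is prime. [folklore] -/
private theorem isPrime_of_ringEquiv_polynomial₃ : N.IsPrime := by
  haveI : IsDomain (D ⧸ N) := MulEquiv.isDomain (Polynomial k) Ξ.symm.toMulEquiv
  exact (Ideal.Quotient.isDomain_iff_prime N).mp inferInstance

include Ξ in
/-- An ideal with quotient `≅ k[T]` is not maximal (`k[T]` is not a field). [folklore] -/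
private theorem not_isMaximal_of_ringEquiv_polynomial₃ : ¬ N.IsMaximal := by
  intro h
  have hF : IsField (D ⧸ N) := (Ideal.Quotient.maximal_ideal_iff_isField_quotient N).mp h
  exact Polynomial.not_isField k (MulEquiv.isField hF Ξ.toMulEquiv)

include Ξ in
/-- Over an ideal with quotient `≅ k[T]`, every strictly larger prime is maximal (`k[T]` is a PID of dimension one).
[folklore] -/
private theorem isMaximal_of_lt_of_ringEquiv_polynomial₃ (w : Ideal D) [w.IsPrime] (hNw : N ≤ w) (hne : w ≠ N) :
    w.IsMaximal := by
  -- `θ : D → k[T]`, surjective with kernel `N`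
  let θ : D →+* Polynomial k := Ξ.symm.toRingHom.comp (Ideal.Quotient.mk N)
  have hθsurj : Function.Surjective θ := Ξ.symm.surjective.comp Ideal.Quotient.mk_surjective
  have hθker : RingHom.ker θ = N := by
    ext d
    rw [RingHom.mem_ker, RingHom.comp_apply, RingEquiv.toRingHom_eq_coe, RingHom.coe_coe,
      EmbeddingLike.map_eq_zero_iff, Ideal.Quotient.eq_zero_iff_mem]
  have hkw : RingHom.ker θ ≤ w := hθker ▸ hNw
  haveI hq : (w.map θ).IsPrime := Ideal.map_isPrime_of_surjective hθsurj hkw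
  have hqne : w.map θ ≠ ⊥ := by
    intro hbot
    apply hne
    refine le_antisymm ?_ hNw
    intro d hd
    have : θ d ∈ w.map θ := Ideal.mem_map_of_mem θ hd
    rw [hbot, Ideal.mem_bot, ← RingHom.mem_ker, hθker] at this
    exact this
  haveI : (w.map θ).IsMaximal := IsPrime.to_maximal_ideal hqne
  have hcomap : (w.map θ).comap θ = w := by
    rw [Ideal.comap_map_of_surjective θ hθsurj, sup_eq_left]
    intro d hd
    exact hkw hd
  rw [← hcomap]
  exact Ideal.comap_isMaximal_of_surjective θ hθsurj

include Ξ in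
/-- If `Ξ(T) = d̄` for the isomorphism `Ξ : k[T] ≅ D/N`, then `d ∉ N`. [folklore] -/
private theorem not_mem_of_ringEquiv_polynomial_X₃ {d : D} (hΞ : Ξ Polynomial.X = Ideal.Quotient.mk N d) : d ∉ N := by
  intro hd
  have h0 : Ξ Polynomial.X = 0 := by rw [hΞ, Ideal.Quotient.eq_zero_iff_mem]; exact hd
  exact Polynomial.X_ne_zero (Ξ.injective (h0.trans (map_zero Ξ).symm))

end Quotient


/-! ## A local-ring lemma: an invertible ideal generated by two elements is generated by one of them -/

/-- In a local ring, if `(u, v) = (t)` with `t` a nonzerodivisor then `(u) = (t)` or `(v) = (t)`. [folklore] -/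
private theorem span_singleton_eq_or_of_span_pair_eq₃ {B : Type u} [CommRing B] [IsLocalRing B] {u v t : B}
    (ht : t ∈ nonZeroDivisors B) (h : Ideal.span {u, v} = Ideal.span {t}) :
    Ideal.span {u} = Ideal.span {t} ∨ Ideal.span {v} = Ideal.span {t} := by
  obtain ⟨bu, hbu⟩ : ∃ b : B, b * t = u := Ideal.mem_span_singleton'.mp (h ▸ Ideal.subset_span (by simp))
  obtain ⟨bv, hbv⟩ : ∃ b : B, b * t = v := Ideal.mem_span_singleton'.mp (h ▸ Ideal.subset_span (by simp))
  obtain ⟨au, av, hauv⟩ : ∃ au av : B, au * u + av * v = t :=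
    Ideal.mem_span_pair.mp (h.symm ▸ Ideal.mem_span_singleton_self t)
  have hsum : au * bu + av * bv = 1 := by
    have h1 : (au * bu + av * bv - 1) * t = 0 := by
      rw [sub_mul, one_mul, add_mul, mul_assoc, mul_assoc, hbu, hbv, hauv, sub_self]
    exact sub_eq_zero.mp ((mem_nonZeroDivisors_iff_right.mp ht) _ h1)
  rcases IsLocalRing.isUnit_or_isUnit_of_add_one hsum with hu | hv
  · left
    rw [← hbu, Ideal.span_singleton_mul_left_unit (isUnit_of_mul_isUnit_right hu)]
  · right
    rw [← hbv, Ideal.span_singleton_mul_left_unit (isUnit_of_mul_isUnit_right hv)]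


/-! ## Symbols: the adapted pair is symmetric -/

/-- If `s ∉ 𝒯` and `s' ∉ 𝒯 + k s` then also `s' ∉ 𝒯` and `s ∉ 𝒯 + k s'`. [folklore] -/
private theorem pair_symm₃ {k : Type u} [Field k] {V : Type u} [AddCommGroup V] [Module k V] {T : Submodule k V}
    {s s' : V} (hs : s ∉ T) (hs' : s' ∉ T ⊔ k ∙ s) : s' ∉ T ∧ s ∉ T ⊔ k ∙ s' := by
  refine ⟨fun h => hs' (Submodule.mem_sup_left h), fun h => ?_⟩
  obtain ⟨τ, hτ, w, hw, hτw⟩ := Submodule.mem_sup.mp h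
  obtain ⟨β, rfl⟩ := Submodule.mem_span_singleton.mp hw
  by_cases hβ : β = 0
  · apply hs
    rw [← hτw, hβ, zero_smul, add_zero]
    exact hτ
  · apply hs'
    have hs'eq : s' = β⁻¹ • s - β⁻¹ • τ := by
      rw [← hτw, smul_add, smul_smul, inv_mul_cancel₀ hβ, one_smul, add_sub_cancel_left]
    rw [hs'eq]
    exact Submodule.sub_mem _ (Submodule.mem_sup_right (Submodule.smul_mem _ _ (Submodule.mem_span_singleton_self _)))
      (Submodule.mem_sup_left (T.smul_mem _ hτ))


/-! ## Localisations of `D/N ≅ k[T]` -/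

/-- **Localising the ring `D/N ≅ k[T]` of `ℙ(Dir)`**: for a prime `w ⊇ N` and a localisation `L` of `D` at `w`, the ring
`L/N L` is a localisation of `k[T]` at a prime, hence a regular local ring — a discrete valuation ring of dimension `1`
if `w ≠ N`, the field `k(T)` of dimension `0` if `w = N`. [folklore] -/
private
theorem regular_quotient_of_ringEquiv_polynomial {D : Type u} [CommRing D] {k : Type u} [Field k]
    (N : Ideal D) (Ξ : Polynomial k ≃+* D ⧸ N) (w : Ideal D) [w.IsPrime] (hNw : N ≤ w)
    (L : Type u) [CommRing L] [Algebra D L] [IsLocalization.AtPrime L w] :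
    IsRegularLocalRing (L ⧸ N.map (algebraMap D L)) ∧
      (w ≠ N → ringKrullDim (L ⧸ N.map (algebraMap D L)) = 1) ∧
      (w = N → ringKrullDim (L ⧸ N.map (algebraMap D L)) = 0) := by
  classical
  set Q := L ⧸ N.map (algebraMap D L) with hQ
  -- `w̄ ⊆ D/N`
  set wb : Ideal (D ⧸ N) := w.map (Ideal.Quotient.mk N) with hwb
  have hker : RingHom.ker (Ideal.Quotient.mk N) ≤ w := by rw [Ideal.mk_ker]; exact hNw
  haveI hwbp : wb.IsPrime := Ideal.map_isPrime_of_surjective Ideal.Quotient.mk_surjective hker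
  have hcomap : wb.comap (Ideal.Quotient.mk N) = w := by
    rw [hwb, Ideal.comap_map_of_surjective _ Ideal.Quotient.mk_surjective, sup_eq_left]
    intro d hd
    exact hker hd
  -- `Q` is the localisation of `D/N` at `w̄`
  have hsub : Algebra.algebraMapSubmonoid (D ⧸ N) w.primeCompl = wb.primeCompl := by
    ext q
    constructor
    · rintro ⟨s, hs, rfl⟩
      intro hq
      apply hs
      change s ∈ w
      rw [← hcomap, Ideal.mem_comap]
      exact hq
    · intro hq
      obtain ⟨s, rfl⟩ := Ideal.Quotient.mk_surjective q
      refine ⟨s, fun hs => hq ?_, rfl⟩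
      exact Ideal.mem_map_of_mem _ hs
  haveI hQloc : IsLocalization.AtPrime Q wb := by
    have h : IsLocalization (Algebra.algebraMapSubmonoid (D ⧸ N) w.primeCompl) Q := inferInstance
    rwa [hsub] at h
  haveI : IsLocalRing Q := IsLocalization.AtPrime.isLocalRing Q wb
  -- transport to `k[T]`
  set 𝔮 : Ideal (Polynomial k) := wb.comap Ξ.toRingHom with h𝔮
  haveI : 𝔮.IsPrime := Ideal.IsPrime.comap _
  set K := Localization.AtPrime 𝔮 with hK
  have e : K ≃+* Q :=
    IsLocalization.ringEquivOfRingEquiv (M := 𝔮.primeCompl) (T := wb.primeCompl) K Q Ξ (by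
      ext y; constructor
      · rintro ⟨x, hx, rfl⟩
        exact fun h => hx (by simpa [h𝔮, Ideal.mem_comap] using h)
      · intro hy
        refine ⟨Ξ.symm y, fun h => hy ?_, by simp⟩
        simpa [h𝔮, Ideal.mem_comap] using h)
  -- `𝔮 = ⊥ ↔ w = N`
  have hiff : 𝔮 = ⊥ ↔ w = N := by
    constructor
    · intro h0
      refine le_antisymm ?_ hNw
      intro d hd
      have h1 : Ξ.symm (Ideal.Quotient.mk N d) ∈ 𝔮 := by
        rw [h𝔮, Ideal.mem_comap]
        change Ξ (Ξ.symm _) ∈ wb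
        rw [Ξ.apply_symm_apply]
        exact Ideal.mem_map_of_mem _ hd
      rw [h0, Ideal.mem_bot, EmbeddingLike.map_eq_zero_iff, Ideal.Quotient.eq_zero_iff_mem] at h1
      exact h1
    · intro h
      subst h
      rw [h𝔮, eq_bot_iff]
      intro p hp
      rw [Ideal.mem_comap] at hp
      have h2 : wb = ⊥ := by
        rw [hwb, Ideal.map_eq_bot_iff_le_ker, Ideal.mk_ker]
      rw [h2, Ideal.mem_bot] at hp
      rw [Ideal.mem_bot]
      exact Ξ.injective (hp.trans (map_zero Ξ).symm)
  by_cases hw : w = N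
  · -- `𝔮 = ⊥`: `K` is a field
    have h𝔮0 : 𝔮 = ⊥ := hiff.mpr hw
    have hmK : maximalIdeal K = ⊥ := by
      rw [← IsLocalization.AtPrime.map_eq_maximalIdeal 𝔮 K, Ideal.map_eq_bot_iff_le_ker]
      intro p hp
      rw [h𝔮0, Ideal.mem_bot] at hp
      rw [RingHom.mem_ker, hp, map_zero]
    have hFK : IsField K := (IsLocalRing.isField_iff_maximalIdeal_eq).mpr hmK
    have hregK : IsRegularLocalRing K := by
      refine IsRegularLocalRing.of_spanFinrank_maximalIdeal_le _ ?_
      rw [hmK, Submodule.spanFinrank_bot, Nat.cast_zero]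
      exact ringKrullDim_nonneg_of_nontrivial
    haveI := hregK
    refine ⟨IsRegularLocalRing.of_ringEquiv e, fun h => absurd hw h, fun _ => ?_⟩
    rw [← ringKrullDim_eq_of_ringEquiv e]
    exact ringKrullDim_eq_zero_of_isField hFK
  · have h𝔮0 : 𝔮 ≠ ⊥ := fun h => hw (hiff.mp h)
    haveI := IsLocalization.AtPrime.isDiscreteValuationRing_of_dedekind_domain (Polynomial k) h𝔮0 K
    refine ⟨IsRegularLocalRing.of_ringEquiv e, fun _ => ?_, fun h => absurd h hw⟩
    rw [← ringKrullDim_eq_of_ringEquiv e]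
    exact IsDiscreteValuationRing.ringKrullDim_eq_one _

/-! ## Stalks on a chart: the prime of the chart's generic point of `ℙ(Dir)` -/

section Chart

variable {X' : Scheme.{u}} {D : CommRingCat.{u}} (g : Spec D ⟶ X') [IsOpenImmersion g]

/-- **On a chart `g : Spec D → X'`, the prime `𝔭_η ⊆ 𝒪_{X',g(w)}` of the generisation `g(η) ⤳ g(w)` corresponds, under
`𝒪_{X',g(w)} ≅ 𝒪_{Spec D, w} = D_w`, to `η D_w`**: precisely `𝒪_{X',g w}/𝔭_{gη} ≅ 𝒪_{Spec D,w}/η·𝒪_{Spec D,w}` (naturality of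
specialisation maps along `g`, the affine description of `𝔭_η` on `Spec D`, and `IsLocalization.map_under`).
[cite: StacksProject, Tag 01J7] -/
theorem nonempty_quotient_primeOfSpecializes_ringEquiv (η w : Spec D) (h' : η ⤳ w) (h : g η ⤳ g w) :
    letI : Algebra D ((Spec D).presheaf.stalk w) :=
      ((Scheme.ΓSpecIso D).inv ≫ (Spec D).presheaf.germ ⊤ w trivial).hom.toAlgebra
    Nonempty ((X'.presheaf.stalk (g w) ⧸ primeOfSpecializes h) ≃+*
      ((Spec D).presheaf.stalk w ⧸ η.asIdeal.map (algebraMap D ((Spec D).presheaf.stalk w)))) := by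
  classical
  -- the local dictionaries at `w` and at `η`
  let τ : D ⟶ (Spec D).presheaf.stalk w := (Scheme.ΓSpecIso D).inv ≫ (Spec D).presheaf.germ ⊤ w trivial
  letI : Algebra D ((Spec D).presheaf.stalk w) := τ.hom.toAlgebra
  haveI hlocL : IsLocalization.AtPrime ((Spec D).presheaf.stalk w) w.asIdeal :=
    StructureSheaf.IsLocalization.to_stalk (R := D) w
  let τη : D ⟶ (Spec D).presheaf.stalk η := (Scheme.ΓSpecIso D).inv ≫ (Spec D).presheaf.germ ⊤ η trivial
  let σ : ↑(X'.presheaf.stalk (g w)) ≃+* ↑((Spec D).presheaf.stalk w) :=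
    (asIso (g.stalkMap w)).commRingCatIsoToRingEquiv
  have hσ : ∀ b, σ b = (g.stalkMap w).hom b := fun _ => rfl
  -- `P' = 𝔭_η` on `Spec D`, `P = 𝔭_{gη}` on `X'`
  set P' : Ideal ((Spec D).presheaf.stalk w) := primeOfSpecializes h' with hP'
  set P : Ideal (X'.presheaf.stalk (g w)) := primeOfSpecializes h with hP
  -- (1) `P = P'.comap σ`
  haveI : IsLocalHom (g.stalkMap η).hom := g.toLRSHom.prop η
  have hmη : (maximalIdeal ((Spec D).presheaf.stalk η)).comap (g.stalkMap η).hom =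
      maximalIdeal (X'.presheaf.stalk (g η)) :=
    ((IsLocalRing.local_hom_TFAE (g.stalkMap η).hom).out 0 4).mp (g.toLRSHom.prop η)
  have hPP' : P = P'.comap (g.stalkMap w).hom := by
    rw [hP, hP', primeOfSpecializes, primeOfSpecializes, ← hmη, Ideal.comap_comap, Ideal.comap_comap]
    congr 1
    rw [← CommRingCat.hom_comp, ← CommRingCat.hom_comp]
    exact congrArg CommRingCat.Hom.hom (Scheme.Hom.stalkSpecializes_stalkMap g η w h')
  -- (2) `P'.comap τ = η`
  have hP'τ : P'.comap τ.hom = η.asIdeal := by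
    have h1 : P'.comap ((Spec D).presheaf.germ ⊤ w trivial).hom =
        ((isAffineOpen_top (Spec D)).primeIdealOf ⟨η, h'.mem_open isOpen_univ trivial⟩).asIdeal :=
      comap_germ_primeOfSpecializes h' ⟨⊤, isAffineOpen_top (Spec D)⟩ trivial
    have h2 : ((isAffineOpen_top (Spec D)).primeIdealOf ⟨η, h'.mem_open isOpen_univ trivial⟩).asIdeal =
        (maximalIdeal ((Spec D).presheaf.stalk η)).comap ((Spec D).presheaf.germ ⊤ η trivial).hom := by
      rw [IsAffineOpen.primeIdealOf_eq_map_closedPoint]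
      rfl
    have h3 : ((maximalIdeal ((Spec D).presheaf.stalk η)).comap ((Spec D).presheaf.germ ⊤ η trivial).hom).comap
        (Scheme.ΓSpecIso D).inv.hom = η.asIdeal := by
      letI : Algebra D ((Spec D).presheaf.stalk η) := τη.hom.toAlgebra
      haveI : IsLocalization.AtPrime ((Spec D).presheaf.stalk η) η.asIdeal :=
        StructureSheaf.IsLocalization.to_stalk (R := D) η
      ext d
      rw [Ideal.comap_comap, Ideal.mem_comap]
      exact (IsLocalization.AtPrime.to_map_mem_maximal_iff ((Spec D).presheaf.stalk η) η.asIdeal d)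
    change P'.comap ((Scheme.ΓSpecIso D).inv ≫ (Spec D).presheaf.germ ⊤ w trivial).hom = η.asIdeal
    rw [CommRingCat.hom_comp, ← Ideal.comap_comap, h1, h2, h3]
  have hP'map : η.asIdeal.map (algebraMap D ((Spec D).presheaf.stalk w)) = P' := by
    have h := IsLocalization.map_under (M := w.asIdeal.primeCompl) (S := (Spec D).presheaf.stalk w) P'
    rw [Ideal.under_def] at h
    have hτalg : (algebraMap D ((Spec D).presheaf.stalk w)) = τ.hom := rfl
    rw [hτalg] at h ⊢
    rw [hP'τ] at h
    exact h
  -- (3) the quotient isomorphism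
  have hIJ : P' = P.map (σ : ↑(X'.presheaf.stalk (g w)) →+* ↑((Spec D).presheaf.stalk w)) := by
    rw [hPP']
    exact (Ideal.map_comap_of_surjective (g.stalkMap w).hom (by exact σ.surjective) P').symm
  rw [hP'map]
  exact ⟨Ideal.quotientEquiv P P' σ hIJ⟩

end Chart


/-! ## One chart: the local rings of `ℙ(Dir)` at the points of a chart piece `≅ Spec k[T]` -/

section ChartLocal

variable {X' : Scheme.{u}} {D : CommRingCat.{u}} (g : Spec D ⟶ X') [IsOpenImmersion g] {k : Type u} [Field k]
  (S : Set X') (hC : IsClosed S) (N : Ideal D) (Ξ : Polynomial k ≃+* D ⧸ N)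
  (hkey : ∀ w : Spec D, g w ∈ S ↔ N ≤ w.asIdeal) (hN : N.IsPrime)
  (hGP : IsGenericPoint (g ⟨N, hN⟩) S)

include Ξ hkey hGP in
/-- **On a chart `g : Spec D → X'` on which the closed set `S` is `V(N)` with `D/N ≅ k[T]` and whose point `N` is generic in
`S`, the local rings `𝒪_{X',y}/𝓘_{S,y}` at the points `y = g(w)` of `S` are regular, of dimension `1` at `y ≠ g(N)` and `0`
at `y = g(N)`** (`𝓘_{S,y} = 𝔭_{g(N)}`, `stalkIdeal_vanishingIdeal_closure`; then
`nonempty_quotient_primeOfSpecializes_ringEquiv` and the localisations of `k[T]`). [cite: CossartJannsenSaito2020, Def. 6.38 (ii), p. 105] -/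
theorem isRegularLocalRing_quotient_stalkIdeal_of_chart (w : Spec D) (hy : g w ∈ S) :
    IsRegularLocalRing (X'.presheaf.stalk (g w) ⧸ stalkIdeal (Scheme.IdealSheafData.vanishingIdeal ⟨S, hC⟩) (g w)) ∧
      (¬ IsGenericPoint (g w) S →
        ringKrullDim (X'.presheaf.stalk (g w) ⧸
          stalkIdeal (Scheme.IdealSheafData.vanishingIdeal ⟨S, hC⟩) (g w)) = 1) ∧
      (IsGenericPoint (g w) S →
        ringKrullDim (X'.presheaf.stalk (g w) ⧸
          stalkIdeal (Scheme.IdealSheafData.vanishingIdeal ⟨S, hC⟩) (g w)) = 0) := by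
  classical
  set ηpt : Spec D := ⟨N, hN⟩ with hηpt
  have hNw : N ≤ w.asIdeal := (hkey w).mp hy
  have h' : ηpt ⤳ w :=
    (PrimeSpectrum.le_iff_specializes ηpt w).mp ((PrimeSpectrum.asIdeal_le_asIdeal ηpt w).mp hNw)
  have h : g ηpt ⤳ g w := h'.map g.continuous
  have hCl : (⟨S, hC⟩ : Closeds X') = ⟨closure {g ηpt}, isClosed_closure⟩ := Closeds.ext hGP.symm
  have hstalk : stalkIdeal (Scheme.IdealSheafData.vanishingIdeal ⟨S, hC⟩) (g w) = primeOfSpecializes h := by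
    rw [hCl]
    exact stalkIdeal_vanishingIdeal_closure h
  -- `g w` generic iff `w = N`
  have hgen_iff : IsGenericPoint (g w) S ↔ w.asIdeal = N := by
    constructor
    · intro hg
      have heq : g w = g ηpt := hg.eq hGP
      have : w = ηpt := g.isOpenEmbedding.injective heq
      rw [this]
    · intro heq
      have : w = ηpt := PrimeSpectrum.ext heq
      rw [this]
      exact hGP
  -- transport to `𝒪_{Spec D, w} / N`
  letI : Algebra D ((Spec D).presheaf.stalk w) :=
    ((Scheme.ΓSpecIso D).inv ≫ (Spec D).presheaf.germ ⊤ w trivial).hom.toAlgebra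
  haveI hlocL : IsLocalization.AtPrime ((Spec D).presheaf.stalk w) w.asIdeal :=
    StructureSheaf.IsLocalization.to_stalk (R := D) w
  obtain ⟨e⟩ := nonempty_quotient_primeOfSpecializes_ringEquiv g ηpt w h' h
  obtain ⟨hreg, hdim1, hdim0⟩ :=
    regular_quotient_of_ringEquiv_polynomial N Ξ w.asIdeal hNw ((Spec D).presheaf.stalk w)
  rw [hstalk]
  haveI := hreg
  refine ⟨IsRegularLocalRing.of_ringEquiv e.symm, fun hng => ?_, fun hg => ?_⟩
  · rw [ringKrullDim_eq_of_ringEquiv e]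
    exact hdim1 (fun heq => hng (hgen_iff.mpr heq))
  · rw [ringKrullDim_eq_of_ringEquiv e]
    exact hdim0 (hgen_iff.mp hg)

end ChartLocal

/-! ## The theorem -/

set_option maxHeartbeats 1600000 in
-- one long proof over large chart types (two Rees charts `chartRing c j` over `Γ(X, U)`), as in `ProjDirLine.lean`
/-- **CJS 2020, Def. 6.38 (ii) at `e_x(X) = 2`, local part, PROVED: the local rings of `C_1 = ℙ(Dir_x(X))` (reduced
closed subscheme of `X' = Bℓ_x(X)`) are regular, of dimension `1` at the closed points and `0` at the generic point** — for
a blow-up `π : X' ⟶ X` of a locally noetherian `X` in a closed point `x` with `e_x(X) = 2` and `C = projDirectrixFibre π x`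
(closed, `hC`), at every `y ∈ C`: `𝒪_{X',y}/𝓘_{C,y}` is a regular local ring, `dim = 1` if `y` is not the generic point of
`C` and `dim = 0` if it is (clause (5) of `ProjDir_projLine`; `dim(𝒪_{C_1,y})` of p. 103 L30).
[cite: CossartJannsenSaito2020, Def. 6.38 (ii), p. 105] -/
theorem projDirectrixFibre_projLine_local {X X' : Scheme.{u}} [IsLocallyNoetherian X] (π : X' ⟶ X) (x : X)
    (hx : IsClosed ({x} : Set X)) (hπ : IsBlowup π (Scheme.IdealSheafData.vanishingIdeal ⟨{x}, hx⟩))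
    (hdir : Scheme.dirDim X x = 2) (hC : IsClosed (projDirectrixFibre π x)) (y : X')
    (hy : y ∈ projDirectrixFibre π x) :
    IsRegularLocalRing (X'.presheaf.stalk y ⧸
      stalkIdeal (Scheme.IdealSheafData.vanishingIdeal ⟨projDirectrixFibre π x, hC⟩) y) ∧
    (¬ IsGenericPoint y (projDirectrixFibre π x) →
      ringKrullDim (X'.presheaf.stalk y ⧸
        stalkIdeal (Scheme.IdealSheafData.vanishingIdeal ⟨projDirectrixFibre π x, hC⟩) y) = 1) ∧
    (IsGenericPoint y (projDirectrixFibre π x) →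
      ringKrullDim (X'.presheaf.stalk y ⧸
        stalkIdeal (Scheme.IdealSheafData.vanishingIdeal ⟨projDirectrixFibre π x, hC⟩) y) = 0) := by
  classical
  set S := projDirectrixFibre π x with hS
  -- (0) the centre, an affine open `U ∋ x`, `𝔭 = 𝔭_x ⊆ R = Γ(X, U)`, `𝒪_{X,x} = R_𝔭`
  obtain ⟨U, hxU⟩ : ∃ U : X.affineOpens, x ∈ (U : X.Opens) := by
    obtain ⟨U₀, hU, hxU, -⟩ :=
      exists_isAffineOpen_mem_and_subset (X := X) (x := x) (U := ⊤) (Opens.mem_top x)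
    exact ⟨⟨U₀, hU⟩, hxU⟩
  set A := X.presheaf.stalk x with hA
  obtain ⟨𝔭, h𝔭⟩ : ∃ 𝔭 : PrimeSpectrum Γ(X, U), 𝔭 = U.2.primeIdealOf ⟨x, hxU⟩ := ⟨_, rfl⟩
  haveI h𝔭max : 𝔭.asIdeal.IsMaximal := h𝔭 ▸ U.2.primeIdealOf_isMaximal_of_isClosed ⟨x, hxU⟩ hx
  haveI : IsNoetherianRing Γ(X, U) := IsLocallyNoetherian.component_noetherian U
  letI : Algebra Γ(X, U) A := TopCat.Presheaf.algebra_section_stalk X.presheaf (⟨x, hxU⟩ : (U : X.Opens))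
  haveI hloc : IsLocalization.AtPrime A 𝔭.asIdeal := h𝔭 ▸ U.2.isLocalization_stalk ⟨x, hxU⟩
  have halg : ∀ s : Γ(X, U), algebraMap Γ(X, U) A s = (X.presheaf.germ U x hxU).hom s := fun _ => rfl
  have hI : (Scheme.IdealSheafData.vanishingIdeal (⟨{x}, hx⟩ : Closeds X)).ideal U = 𝔭.asIdeal := by
    rw [h𝔭]
    exact vanishingIdeal_singleton_ideal U.2 hx hxU
  obtain ⟨r, c, hc⟩ : ∃ (r : ℕ) (c : Fin r → Γ(X, U)), Ideal.span (Set.range c) = 𝔭.asIdeal :=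
    Submodule.fg_iff_exists_fin_generating_family.mp (IsNoetherian.noetherian 𝔭.asIdeal)
  have hIc : (Scheme.IdealSheafData.vanishingIdeal (⟨{x}, hx⟩ : Closeds X)).ideal U = Ideal.span (Set.range c) :=
    hI.trans hc.symm
  have hcm : ∀ l, algebraMap Γ(X, U) A (c l) ∈ maximalIdeal A :=
    fun l => (IsLocalization.AtPrime.to_map_mem_maximal_iff A 𝔭.asIdeal (c l)).mpr
      (hc ▸ Ideal.subset_span ⟨l, rfl⟩)
  have hspanA : Ideal.span (Set.range fun l => algebraMap Γ(X, U) A (c l)) = maximalIdeal A := by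
    have h := IsLocalization.AtPrime.map_eq_maximalIdeal 𝔭.asIdeal A
    rwa [← hc, Ideal.map_span, ← Set.range_comp] at h
  have hexp : ∀ l, ∃ a : Fin (maximalIdeal A).spanFinrank → A,
      ∑ i, a i * minGenerators A i = algebraMap Γ(X, U) A (c l) :=
    fun l => Ideal.mem_span_range_iff_exists_fun.mp (by rw [span_range_minGenerators]; exact hcm l)
  choose a ha using hexp
  have ha' : ∀ l, algebraMap Γ(X, U) A (c l) = ∑ i, a l i * minGenerators A i := fun l => (ha l).symm
  have hd : directrixDim (tangentConeIdeal (minGenerators A) (span_range_minGenerators A)) = 2 := hdir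
  -- (1) the charts at the generators, and the chart description of `S`
  have hcharts := fun j => exists_chart_of_ideal_eq_span₃ hπ U c hIc j
  choose g hgopen hgπ hgmem using hcharts
  have hkey : ∀ (j : Fin r) (w : Spec (.of (chartRing c j))),
      g j w ∈ S ↔
        ((U.2.primeIdealOf ⟨x, hxU⟩).asIdeal.map (CommRingCat.ofHom (chartBase c j)).hom ⊔
          Ideal.span {d : chartRing c j | ∃ lam : Fin r → Γ(X, U),
            (linForm fun i => ∑ l, residue (X.presheaf.stalk x) ((X.presheaf.germ U x hxU).hom (lam l)) *
                residue (X.presheaf.stalk x) (a l i)) ∈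
              directrixSpace (canonicalTangentConeIdeal (X.presheaf.stalk x)) ∧
            d = ∑ l, (CommRingCat.ofHom (chartBase c j)).hom (lam l) * chartGen c j l}) ≤ w.asIdeal := by
    intro j w
    haveI := hgopen j
    exact mem_projDirectrixFibre_chart_iff π U hxU (CommRingCat.ofHom (chartBase c j)) c j
      (fun l => chartGen c j l) a (g j) (hgπ j) (fun k => reesChartBase_apply_eq_mul_chartGen c j k)
      (reesChartBase_mem_nonZeroDivisors (c j) (Ideal.mem_span_range_self (f := c) (x := j))) hx
      (h𝔭 ▸ hc) ha w
  -- (2) an adapted pair of generators `c_{j₀}, c_{j₁}`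
  obtain ⟨j₀, j₁, hj₀, hj₁⟩ := exists_pair_symbols_compl_directrixSpace (span_range_minGenerators A) rfl hspanA a ha' hd
  -- (3) per-chart structure for an adapted ordered pair `(i, i')`, with the isomorphism `Ξ`
  letI instF : Field (Γ(X, U) ⧸ 𝔭.asIdeal) := Ideal.Quotient.field 𝔭.asIdeal
  have hchart : ∀ (i i' : Fin r),
      linForm (fun m => residue A (a i m)) ∉
        directrixSpace (tangentConeIdeal (minGenerators A) (span_range_minGenerators A)) →
      linForm (fun m => residue A (a i' m)) ∉
        directrixSpace (tangentConeIdeal (minGenerators A) (span_range_minGenerators A)) ⊔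
          (ResidueField A) ∙ linForm (fun m => residue A (a i m)) →
      ∃ (N : Ideal (chartRing c i)) (_ : Polynomial (Γ(X, U) ⧸ 𝔭.asIdeal) ≃+* chartRing c i ⧸ N),
        (∀ w : Spec (.of (chartRing c i)), g i w ∈ S ↔ N ≤ w.asIdeal) ∧
        N.IsPrime ∧ ¬ N.IsMaximal ∧
        (∀ w : Ideal (chartRing c i), w.IsPrime → N ≤ w → w ≠ N → w.IsMaximal) ∧ chartGen c i i' ∉ N := by
    intro i i' hi hi'
    obtain ⟨Ξ, -, hΞX⟩ := exists_ringEquiv_polynomial_quotient_chartIdeal 𝔭.asIdeal A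
      (span_range_minGenerators A) a ha (chartBase c i) (fun l => chartGen c i l) i i' (chartGen_self c i)
      (fun d => exists_isHomogeneous_eval₂_eq c i d) (fun m F hF => reesChartBase_eval_eq_pow_mul_eval₂ c i hF)
      (fun z hz => exists_pow_mul_eq_zero_of_reesChartBase_eq_zero c i hz) hi hi' hd
    refine ⟨_, Ξ, fun w => ?_, isPrime_of_ringEquiv_polynomial₃ _ Ξ, not_isMaximal_of_ringEquiv_polynomial₃ _ Ξ,
      fun w hw hNw hne => ?_, ?_⟩
    · rw [hkey i w, h𝔭]
      exact Iff.rfl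
    · haveI := hw
      exact isMaximal_of_lt_of_ringEquiv_polynomial₃ _ Ξ w hNw hne
    · exact not_mem_of_ringEquiv_polynomial_X₃ _ Ξ hΞX
  obtain ⟨N₀, Ξ₀, hkey₀, hprime₀, hnmax₀, hmax₀, hgen₀⟩ := hchart j₀ j₁ hj₀ hj₁
  obtain ⟨hj₁', hj₀'⟩ := pair_symm₃ hj₀ hj₁
  obtain ⟨N₁, Ξ₁, hkey₁, hprime₁, hnmax₁, hmax₁, hgen₁⟩ := hchart j₁ j₀ hj₁' hj₀'
  haveI := hgopen j₀
  haveI := hgopen j₁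
  set η₀pt : Spec (.of (chartRing c j₀)) := ⟨N₀, hprime₀⟩ with hη₀pt
  set η₁pt : Spec (.of (chartRing c j₁)) := ⟨N₁, hprime₁⟩ with hη₁pt
  have hη₀S : g j₀ η₀pt ∈ S := (hkey₀ η₀pt).mpr le_rfl
  have hη₁S : g j₁ η₁pt ∈ S := (hkey₁ η₁pt).mpr le_rfl
  -- (4) every point of `S` lies on one of the two charts
  have hcover2 : ∀ ξ ∈ S, ξ ∈ Set.range (g j₀) ∨ ξ ∈ Set.range (g j₁) := by
    intro ξ hξ
    obtain ⟨hξx, hP⟩ := (mem_projDirectrixFibre π x ξ).mp hξ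
    have hξU : π.base ξ ∈ (U : X.Opens) := hξx ▸ hxU
    let ι : A ≅ X.presheaf.stalk (π.base ξ) := X.presheaf.stalkCongr (.of_eq hξx.symm)
    haveI : IsLocalHom (π.stalkMap ξ).hom := π.toLRSHom.prop ξ
    let φ : A →+* X'.presheaf.stalk ξ := (π.stalkMap ξ).hom.comp ι.hom.hom
    have hφgerm : ∀ s : Γ(X, U), φ (algebraMap Γ(X, U) A s) =
        (π.stalkMap ξ).hom ((X.presheaf.germ U (π.base ξ) hξU).hom s) := by
      intro s
      rw [halg, RingHom.comp_apply]
      change (π.stalkMap ξ).hom ((X.presheaf.germ U x hxU ≫ ι.hom).hom s) = _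
      rw [TopCat.Presheaf.stalkCongr_hom, TopCat.Presheaf.germ_stalkSpecializes]
    have hφm : (maximalIdeal A).map φ ≤ maximalIdeal (X'.presheaf.stalk ξ) := by
      rw [Ideal.map_le_iff_le_comap]
      intro m hm
      rw [Ideal.mem_comap, RingHom.comp_apply]
      refine map_nonunit (π.stalkMap ξ).hom _ ?_
      rw [mem_maximalIdeal, mem_nonunits_iff] at hm ⊢
      have h2 : ι.inv.hom (ι.hom.hom m) = m := by
        change (ι.hom ≫ ι.inv).hom m = m
        rw [Iso.hom_inv_id]
        rfl
      exact fun hu => hm (h2 ▸ hu.map ι.inv.hom)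
    have hPφ : ProjDirLiftsInto φ (minGenerators A) (span_range_minGenerators A) :=
      (isOnProjDirectrix_iff_projDirLiftsInto π hξx).mp hP
    have hpair := map_maximalIdeal_eq_span_pair_of_projDirLiftsInto (span_range_minGenerators A) a ha' hj₀ hj₁ hd φ
      hφm hPφ
    obtain ⟨t, ht, hKt⟩ := hπ.isEffectiveCartier.exists_stalkIdeal_eq_span ξ
    have hK : stalkIdeal ((Scheme.IdealSheafData.vanishingIdeal (⟨{x}, hx⟩ : Closeds X)).comap π) ξ =
        Ideal.span {(π.stalkMap ξ).hom ((X.presheaf.germ U (π.base ξ) hξU).hom (c j₀)),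
          (π.stalkMap ξ).hom ((X.presheaf.germ U (π.base ξ) hξU).hom (c j₁))} := by
      rw [stalkIdeal_comap_eq_map, stalkIdeal_eq_map_germ _ U hξU, hIc, Ideal.map_map, Ideal.map_span,
        ← Set.range_comp]
      have h1 : Ideal.span (Set.range (((π.stalkMap ξ).hom.comp (X.presheaf.germ U (π.base ξ) hξU).hom) ∘ c)) =
          (maximalIdeal A).map φ := by
        rw [← hspanA, Ideal.map_span, ← Set.range_comp]
        exact congrArg Ideal.span (congrArg Set.range (funext fun l => (hφgerm (c l)).symm))
      rw [h1, hpair, hφgerm, hφgerm]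
    rcases span_singleton_eq_or_of_span_pair_eq₃ ht (hK.symm.trans hKt) with h0 | h1
    · exact Or.inl (hgmem j₀ ξ hξU (hKt.trans h0.symm))
    · exact Or.inr (hgmem j₁ ξ hξU (hKt.trans h1.symm))
  -- (5) specialisation from the chart generic points; both are generic points of `S`
  have hspec₀ : ∀ w : Spec (.of (chartRing c j₀)), g j₀ w ∈ S → g j₀ η₀pt ⤳ g j₀ w := by
    intro w hw
    have hsp : η₀pt ⤳ w :=
      (PrimeSpectrum.le_iff_specializes η₀pt w).mp ((PrimeSpectrum.asIdeal_le_asIdeal η₀pt w).mp ((hkey₀ w).mp hw))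
    exact hsp.map (g j₀).continuous
  have hspec₁ : ∀ w : Spec (.of (chartRing c j₁)), g j₁ w ∈ S → g j₁ η₁pt ⤳ g j₁ w := by
    intro w hw
    have hsp : η₁pt ⤳ w :=
      (PrimeSpectrum.le_iff_specializes η₁pt w).mp ((PrimeSpectrum.asIdeal_le_asIdeal η₁pt w).mp ((hkey₁ w).mp hw))
    exact hsp.map (g j₁).continuous
  have hη₁range₀ : g j₁ η₁pt ∈ Set.range (g j₀) := by
    have hwU : π (g j₁ η₁pt) ∈ (U : X.Opens) := ((mem_projDirectrixFibre π x _).mp hη₁S).1 ▸ hxU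
    exact hgmem j₀ _ hwU (stalkIdeal_exceptional_eq_span_of_notMem π U (CommRingCat.ofHom (chartBase c j₁)) c j₁
      (fun l => chartGen c j₁ l) (g j₁) (hgπ j₁) (fun k => reesChartBase_apply_eq_mul_chartGen c j₁ k) hx hIc
      η₁pt hwU j₀ hgen₁)
  have hη₀range₁ : g j₀ η₀pt ∈ Set.range (g j₁) := by
    have hwU : π (g j₀ η₀pt) ∈ (U : X.Opens) := ((mem_projDirectrixFibre π x _).mp hη₀S).1 ▸ hxU
    exact hgmem j₁ _ hwU (stalkIdeal_exceptional_eq_span_of_notMem π U (CommRingCat.ofHom (chartBase c j₀)) c j₀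
      (fun l => chartGen c j₀ l) (g j₀) (hgπ j₀) (fun k => reesChartBase_apply_eq_mul_chartGen c j₀ k) hx hIc
      η₀pt hwU j₁ hgen₀)
  have hη₀η₁ : g j₀ η₀pt ⤳ g j₁ η₁pt := by
    obtain ⟨w, hw⟩ := hη₁range₀
    rw [← hw]
    exact hspec₀ w (hw ▸ hη₁S)
  have hη₁η₀ : g j₁ η₁pt ⤳ g j₀ η₀pt := by
    obtain ⟨w, hw⟩ := hη₀range₁
    rw [← hw]
    exact hspec₁ w (hw ▸ hη₀S)
  have hgen : ∀ ξ ∈ S, g j₀ η₀pt ⤳ ξ := by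
    intro ξ hξ
    rcases hcover2 ξ hξ with ⟨w, rfl⟩ | ⟨w, rfl⟩
    · exact hspec₀ w hξ
    · exact hη₀η₁.trans (hspec₁ w hξ)
  have hGP₀ : IsGenericPoint (g j₀ η₀pt) S := by
    refine isGenericPoint_iff_specializes.mpr fun ξ => ⟨fun h => ?_, fun h => hgen ξ h⟩
    exact hC.closure_subset_iff.mpr (Set.singleton_subset_iff.mpr hη₀S) (specializes_iff_mem_closure.mp h)
  have hGP₁ : IsGenericPoint (g j₁ η₁pt) S := by
    refine isGenericPoint_iff_specializes.mpr fun ξ => ⟨fun h => ?_, fun h => hη₁η₀.trans (hgen ξ h)⟩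
    exact hC.closure_subset_iff.mpr (Set.singleton_subset_iff.mpr hη₁S) (specializes_iff_mem_closure.mp h)
  -- (6) the local computation on a chart through `y`
  rcases hcover2 y hy with ⟨w, rfl⟩ | ⟨w, rfl⟩
  · exact isRegularLocalRing_quotient_stalkIdeal_of_chart (g j₀) S hC N₀ Ξ₀ hkey₀ hprime₀ hGP₀ w hy
  · exact isRegularLocalRing_quotient_stalkIdeal_of_chart (g j₁) S hC N₁ Ξ₁ hkey₁ hprime₁ hGP₁ w hy

/-- **CJS 2020, Def. 6.38 (ii) / Def. 6.34 (i) / p. 105 L13 at `t = e_x(X) = 2`, PROVED: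
`C_1 = ℙ(Dir_x(X)) ≅ ℙ^1_{k(x)}`** in the tree's locus / local-ring rendering — discharges the named fact
`ProjDir_projLine` of `ProjDirProjectiveLine.lean` (`projDirectrixFibre_projLine_topology` + `projDirectrixFibre_projLine_local`).
[cite: CossartJannsenSaito2020, Def. 6.38 (ii), p. 105] -/
theorem ProjDir_projLine_holds : ProjDir_projLine.{u} := by
  intro X X' _ π x hx hπ hdir
  obtain ⟨h1, h2, h3, h4⟩ := projDirectrixFibre_projLine_topology π x hx hπ hdir
  exact ⟨h1, h2, h3, h4, fun hC y hy => projDirectrixFibre_projLine_local π x hx hπ hdir hC y hy⟩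

end Literature.AlgebraicGeometry.CossartJannsenSaito2020

end
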